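import Literature.NumberTheory.LFunctions.ConreyIwaniec2002KernelMellin
import Literature.NumberTheory.LFunctions.ConreyIwaniec2002GenusZFactorBounds
import Literature.NumberTheory.LFunctions.ConreyIwaniec2002Thm61DivisorMoments
import HarnessLib

/-!
# Conrey–Iwaniec (2002), Theorem 6.1: the off-diagonal series `Σ_h σ(h)∫|a|²L(hT/y)dy = ∫|a|²D(T/y)dy` (6.29)–(6.30)

B. Conrey, H. Iwaniec, Acta Arith. 103 (2002), §6 (6.29)–(6.31) [held text
`paper:arxiv-math_0111012`, p0015]. For `|σ(h)| ≤ C₁σ₋₁(h)` (6.20), an admissible kernel `K`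
(`|L(v)| ≤ (1+|v|)⁻⁴`, `L = ciL K`) and `g` with `|g(y)| ≤ (1+y/Y)⁻⁴` on `y > 0`:
`Σ_{h≥1} σ(h)∫₀^∞|g(y)|²L(hT/y)dy = ∫₀^∞|g(y)|²D(T/y)dy` with `D(v) = Σ_h σ(h)L(hv)` (6.29)
(absolute convergence), the truncation at `h ≤ H`:
`|Σ_{h>H} σ(h)∫|g|²L(hT/y)dy| ≤ 2C₁Y³T⁻²(2+log H)/H` (from `|L(v)| ≤ v⁻²`, `σ₋₁(h) ≤ 1+log h`),
the crude bound `|∫|g|²D(T/y)dy| ≤ 6C₁Y³T⁻²`, the moments `∫₀^∞ y^{c-1}|g|² ≤ 2Y^c` (`1 ≤ c ≤ 5`),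
and the crude bound `|S*(1)| ≤ G₂/T²` for `S*(1) = Σ_n b_{n+1}b̄_n L(T/n)` (6.9)–(6.10).

PROVED HERE (namespace `ConreyIwaniec2002.Thm61OffDiagSeries`): helpers for stub S2c
`stub_thm61_assembly` of SKELETON P64 (line `thm61-cm-convolution`).

## References
* [ConreyIwaniec2002] B. Conrey, H. Iwaniec, Acta Arith. 103 (2002) 259–312: §6 (6.9)–(6.10),
  (6.20), (6.29)–(6.31).
-/

noncomputable section

open MeasureTheory Set Filter Real Finset

namespace Literature.NumberTheory.LFunctions

namespace ConreyIwaniec2002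

namespace Thm61OffDiagSeries

open KernelMellin GenusZFactorBounds Thm61DivisorMoments

/-! ### Bounds for `σ` and `L` -/

/-- `|σ(h)| ≤ C₁(1 + log h)` from (6.20) and `σ₋₁(h) ≤ 1 + log h`. [cite: ConreyIwaniec2002, §6 (6.20)] -/
theorem abs_sigma_le_log {σ : ℕ → ℝ} {C₁ : ℝ} (hC₁ : 0 ≤ C₁)
    (hσ : ∀ h : ℕ, 1 ≤ h → |σ h| ≤ C₁ * ∑ d ∈ Nat.divisors h, (d : ℝ)⁻¹) {h : ℕ} (hh : 1 ≤ h) :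
    |σ h| ≤ C₁ * (1 + Real.log h) :=
  (hσ h hh).trans (mul_le_mul_of_nonneg_left (sum_divisors_inv_le (by omega)) hC₁)

section Kernel

variable {K : ℝ → ℝ} (hK : IsCIKernel K)
include hK

/-- `|L(v)| ≤ 1`. [cite: ConreyIwaniec2002, §6 (6.3)] -/
theorem abs_ciL_le_one (v : ℝ) : |ciL K v| ≤ 1 :=
  (abs_ciL_le hK v).trans (inv_le_one_of_one_le₀ (one_le_pow₀ (by have := abs_nonneg v; linarith)))

/-- `|L(v)| ≤ v⁻²` for `v > 0`. [cite: ConreyIwaniec2002, §6 (6.3), (6.31)] -/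
theorem abs_ciL_le_inv_sq {v : ℝ} (hv : 0 < v) : |ciL K v| ≤ (v ^ 2)⁻¹ := by
  refine (abs_ciL_le hK v).trans (inv_anti₀ (by positivity) ?_)
  rw [abs_of_pos hv]
  calc v ^ 2 ≤ (1 + v) ^ 2 := pow_le_pow_left₀ hv.le (by linarith) 2
    _ ≤ (1 + v) ^ 4 := pow_le_pow_right₀ (by linarith) (by norm_num)

/-- `L` is continuous. [cite: ConreyIwaniec2002, §6 (6.2)–(6.3)] -/
theorem continuous_ciL : Continuous (ciL K) :=
  hK.2.2.2.2.1.continuous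

end Kernel

/-! ### Moments of `|g|²` for `g` in the class (6.14) -/

section Weight

variable {g : ℝ → ℂ} {Y : ℝ} (hY : 2 ≤ Y) (hg : ∀ y : ℝ, 0 < y → ‖g y‖ ≤ ((1 + y / Y) ^ 4)⁻¹)
  (hgc : ContinuousOn g (Ioi 0))
include hY hg hgc

omit hgc in
/-- `|g(y)|² ≤ 1` and `|g(y)|² ≤ (Y/y)⁸` on `y > 0`. [cite: ConreyIwaniec2002, §6 (6.14)] -/
theorem normSq_g_le {y : ℝ} (hy : 0 < y) : ‖g y‖ ^ 2 ≤ 1 ∧ ‖g y‖ ^ 2 ≤ (Y / y) ^ 8 := by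
  have hY0 : 0 < Y := by linarith
  have h0 := hg y hy
  have hyY : 0 ≤ y / Y := by positivity
  have hb : 1 ≤ 1 + y / Y := by linarith
  have hn : 0 ≤ ‖g y‖ := norm_nonneg _
  have h1 : ‖g y‖ ≤ 1 := h0.trans (inv_le_one_of_one_le₀ (one_le_pow₀ hb))
  have h2 : ‖g y‖ ≤ (Y / y) ^ 4 := by
    refine h0.trans ?_
    have : y / Y ≤ 1 + y / Y := by linarith
    calc ((1 + y / Y) ^ 4)⁻¹ ≤ ((y / Y) ^ 4)⁻¹ :=
          inv_anti₀ (by positivity) (pow_le_pow_left₀ (by positivity) this 4)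
      _ = (Y / y) ^ 4 := by rw [← inv_pow, inv_div]
  refine ⟨by nlinarith, ?_⟩
  calc ‖g y‖ ^ 2 ≤ ((Y / y) ^ 4) ^ 2 := pow_le_pow_left₀ hn h2 2
    _ = (Y / y) ^ 8 := by ring

/-- **`∫₀^∞ y^{c-1}|g(y)|² dy ≤ 2Y^c`** for `1 ≤ c ≤ 5` (with integrability).
[cite: ConreyIwaniec2002, §6 (6.14), (6.31)] -/
theorem integral_rpow_mul_normSq_g_le {c : ℝ} (hc : 1 ≤ c) (hc5 : c ≤ 5) :
    IntegrableOn (fun y : ℝ => y ^ (c - 1) * ‖g y‖ ^ 2) (Ioi 0) ∧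
      ∫ y in Ioi (0:ℝ), y ^ (c - 1) * ‖g y‖ ^ 2 ≤ 2 * Y ^ c := by
  have hY0 : 0 < Y := by linarith
  have hb1 : ∀ y, 0 < y → ‖g y‖ ^ 2 ≤ 1 := fun y hy => (normSq_g_le hY hg hy).1
  have hb2 : ∀ y, 0 < y → ‖g y‖ ^ 2 ≤ (Y / y) ^ 8 := fun y hy => (normSq_g_le hY hg hy).2
  have hcont : ContinuousOn (fun y : ℝ => y ^ (c - 1) * ‖g y‖ ^ 2) (Ioi 0) := by
    refine ContinuousOn.mul (fun y hy => ?_) ((hgc.norm).pow 2)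
    exact (Real.continuousAt_rpow_const _ _ (Or.inl (ne_of_gt hy))).continuousWithinAt
  have hnn : ∀ y, 0 < y → 0 ≤ y ^ (c - 1) * ‖g y‖ ^ 2 := fun y hy => by positivity
  -- piece 1: `(0, Y]`
  have hI1 : IntegrableOn (fun y : ℝ => y ^ (c - 1)) (Ioc 0 Y) := by
    have := (intervalIntegral.intervalIntegrable_rpow' (by linarith : -1 < c - 1) (a := 0) (b := Y))
    rwa [intervalIntegrable_iff_integrableOn_Ioc_of_le hY0.le] at this
  have h1 : IntegrableOn (fun y : ℝ => y ^ (c - 1) * ‖g y‖ ^ 2) (Ioc 0 Y) := by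
    refine Integrable.mono' hI1 ((hcont.mono Ioc_subset_Ioi_self).aestronglyMeasurable measurableSet_Ioc) ?_
    refine (ae_restrict_iff' measurableSet_Ioc).mpr (Eventually.of_forall fun y hy => ?_)
    rw [Real.norm_of_nonneg (hnn y hy.1)]
    exact mul_le_of_le_one_right (Real.rpow_nonneg hy.1.le _) (hb1 y hy.1)
  have hv1 : ∫ y in Ioc 0 Y, y ^ (c - 1) * ‖g y‖ ^ 2 ≤ Y ^ c / c := by
    calc ∫ y in Ioc 0 Y, y ^ (c - 1) * ‖g y‖ ^ 2 ≤ ∫ y in Ioc 0 Y, y ^ (c - 1) := by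
          refine setIntegral_mono_on h1 hI1 measurableSet_Ioc fun y hy => ?_
          exact mul_le_of_le_one_right (Real.rpow_nonneg hy.1.le _) (hb1 y hy.1)
      _ = ∫ y in (0:ℝ)..Y, y ^ (c - 1) := (intervalIntegral.integral_of_le hY0.le).symm
      _ = Y ^ c / c := by
          rw [integral_rpow (Or.inl (by linarith)), show c - 1 + 1 = c by ring,
            Real.zero_rpow (by linarith), sub_zero]
  -- piece 2: `(Y, ∞)`
  have hI2 : IntegrableOn (fun y : ℝ => Y ^ 8 * y ^ (c - 9)) (Ioi Y) :=
    (integrableOn_Ioi_rpow_of_lt (by linarith) hY0).const_mul _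
  have hdom2 : ∀ y ∈ Ioi Y, y ^ (c - 1) * ‖g y‖ ^ 2 ≤ Y ^ 8 * y ^ (c - 9) := by
    intro y hy
    have hy0 : 0 < y := lt_trans hY0 hy
    calc y ^ (c - 1) * ‖g y‖ ^ 2 ≤ y ^ (c - 1) * (Y / y) ^ 8 :=
          mul_le_mul_of_nonneg_left (hb2 y hy0) (Real.rpow_nonneg hy0.le _)
      _ = Y ^ 8 * (y ^ (c - 1) * (y ^ (8:ℝ))⁻¹) := by
          rw [div_pow, show (8:ℝ) = ((8:ℕ):ℝ) by norm_num, Real.rpow_natCast]; ring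
      _ = Y ^ 8 * y ^ (c - 9) := by
          rw [← Real.rpow_neg hy0.le, ← Real.rpow_add hy0]; congr 2; ring
  have h2 : IntegrableOn (fun y : ℝ => y ^ (c - 1) * ‖g y‖ ^ 2) (Ioi Y) := by
    refine Integrable.mono' hI2 ((hcont.mono (Ioi_subset_Ioi hY0.le)).aestronglyMeasurable measurableSet_Ioi) ?_
    refine (ae_restrict_iff' measurableSet_Ioi).mpr (Eventually.of_forall fun y hy => ?_)
    rw [Real.norm_of_nonneg (hnn y (lt_trans hY0 hy))]
    exact hdom2 y hy
  have hv2 : ∫ y in Ioi Y, y ^ (c - 1) * ‖g y‖ ^ 2 ≤ Y ^ c / (8 - c) := by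
    calc ∫ y in Ioi Y, y ^ (c - 1) * ‖g y‖ ^ 2 ≤ ∫ y in Ioi Y, Y ^ 8 * y ^ (c - 9) :=
          setIntegral_mono_on h2 hI2 measurableSet_Ioi hdom2
      _ = Y ^ 8 * (-Y ^ (c - 9 + 1) / (c - 9 + 1)) := by
          rw [integral_const_mul, integral_Ioi_rpow_of_lt (by linarith) hY0]
      _ = Y ^ c / (8 - c) := by
          have e : (Y ^ 8 : ℝ) * Y ^ (c - 9 + 1) = Y ^ c := by
            rw [show (Y ^ 8 : ℝ) = Y ^ ((8:ℕ):ℝ) by rw [Real.rpow_natCast], ← Real.rpow_add hY0]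
            norm_num; ring_nf
          have hne : c - 9 + 1 ≠ 0 := by intro h; linarith
          calc Y ^ 8 * (-Y ^ (c - 9 + 1) / (c - 9 + 1)) = (Y ^ 8 * Y ^ (c - 9 + 1)) * (-1 / (c - 9 + 1)) := by ring
            _ = Y ^ c * (-1 / (c - 9 + 1)) := by rw [e]
            _ = Y ^ c / (8 - c) := by
                have : (8 : ℝ) - c ≠ 0 := by intro h; linarith
                field_simp; ring
  have hunion : Ioi (0:ℝ) = Ioc 0 Y ∪ Ioi Y := (Ioc_union_Ioi_eq_Ioi hY0.le).symm
  refine ⟨by rw [hunion]; exact h1.union h2, ?_⟩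
  have hdisj : Disjoint (Ioc (0:ℝ) Y) (Ioi Y) :=
    Set.disjoint_left.mpr fun y hy hy' => absurd hy' (not_lt.mpr hy.2)
  rw [hunion, setIntegral_union hdisj measurableSet_Ioi h1 h2]
  have hYc : 0 ≤ Y ^ c := Real.rpow_nonneg hY0.le _
  have h3 : Y ^ c / c ≤ Y ^ c := div_le_self hYc hc
  have h4 : Y ^ c / (8 - c) ≤ Y ^ c := div_le_self hYc (by linarith)
  linarith

end Weight

/-! ### The series `Σ_h σ(h)∫|g|²L(hT/y)dy`: interchange, truncation, crude bounds -/

section Series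

variable {K : ℝ → ℝ} (hK : IsCIKernel K) {σ : ℕ → ℝ} {C₁ : ℝ} (hC₁ : 0 ≤ C₁)
  (hσ : ∀ h : ℕ, 1 ≤ h → |σ h| ≤ C₁ * ∑ d ∈ Nat.divisors h, (d : ℝ)⁻¹)
  {g : ℝ → ℂ} {Y : ℝ} (hY : 2 ≤ Y) (hg : ∀ y : ℝ, 0 < y → ‖g y‖ ≤ ((1 + y / Y) ^ 4)⁻¹)
  (hgc : ContinuousOn g (Ioi 0)) {T : ℝ} (hT : 0 < T)
include hK hC₁ hσ hY hg hgc hT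

omit hY hg hgc in
/-- The term bound: `|σ(h+1)L((h+1)T/y)| ≤ C₁(y²/T²)(1+log(h+1))/(h+1)²` (`y > 0`).
[cite: ConreyIwaniec2002, §6 (6.29)–(6.31)] -/
theorem abs_term_le {y : ℝ} (hy : 0 < y) (h : ℕ) :
    |σ (h + 1) * ciL K (((h : ℝ) + 1) * (T / y))| ≤
      C₁ * (y ^ 2 / T ^ 2) * ((1 + Real.log ((h : ℝ) + 1)) / ((h : ℝ) + 1) ^ 2) := by
  have hh : (0 : ℝ) < (h : ℝ) + 1 := by positivity
  have hv : 0 < ((h : ℝ) + 1) * (T / y) := by positivity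
  have h1 : |σ (h + 1)| ≤ C₁ * (1 + Real.log ((h : ℝ) + 1)) := by
    have := abs_sigma_le_log hC₁ hσ (h := h + 1) (by omega)
    push_cast at this
    exact this
  have h2 : |ciL K (((h : ℝ) + 1) * (T / y))| ≤ ((((h : ℝ) + 1) * (T / y)) ^ 2)⁻¹ :=
    abs_ciL_le_inv_sq hK hv
  have hlog : 0 ≤ 1 + Real.log ((h : ℝ) + 1) := by
    have := Real.log_nonneg (by linarith : (1:ℝ) ≤ (h : ℝ) + 1); linarith
  rw [abs_mul]
  calc |σ (h + 1)| * |ciL K (((h : ℝ) + 1) * (T / y))|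
      ≤ C₁ * (1 + Real.log ((h : ℝ) + 1)) * ((((h : ℝ) + 1) * (T / y)) ^ 2)⁻¹ :=
        mul_le_mul h1 h2 (abs_nonneg _) (by positivity)
    _ = C₁ * (y ^ 2 / T ^ 2) * ((1 + Real.log ((h : ℝ) + 1)) / ((h : ℝ) + 1) ^ 2) := by
        field_simp

omit hY hg hgc in
/-- **`D(T/y)` converges absolutely and `|D(T/y)| ≤ 3C₁y²/T²`** (`y > 0`).
[cite: ConreyIwaniec2002, §6 (6.29)] -/
theorem ciD_bound {y : ℝ} (hy : 0 < y) :
    Summable (fun h : ℕ => σ (h + 1) * ciL K (((h : ℝ) + 1) * (T / y))) ∧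
      |ciD K σ (T / y)| ≤ 3 * C₁ * (y ^ 2 / T ^ 2) := by
  obtain ⟨hs3, hle3⟩ := tsum_log_div_sq_le_three
  set u : ℕ → ℝ := fun h => C₁ * (y ^ 2 / T ^ 2) * ((1 + Real.log ((h : ℝ) + 1)) / ((h : ℝ) + 1) ^ 2)
  have hu : Summable u := hs3.mul_left _
  have hbd : ∀ h : ℕ, ‖σ (h + 1) * ciL K (((h : ℝ) + 1) * (T / y))‖ ≤ u h := fun h => by
    rw [Real.norm_eq_abs]; exact abs_term_le hK hC₁ hσ hT hy h
  have hs : Summable (fun h : ℕ => σ (h + 1) * ciL K (((h : ℝ) + 1) * (T / y))) :=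
    Summable.of_norm_bounded hu hbd
  refine ⟨hs, ?_⟩
  have hns : Summable (fun h : ℕ => ‖σ (h + 1) * ciL K (((h : ℝ) + 1) * (T / y))‖) :=
    Summable.of_nonneg_of_le (fun _ => norm_nonneg _) hbd hu
  unfold ciD
  rw [← Real.norm_eq_abs]
  calc ‖∑' h : ℕ, σ (h + 1) * ciL K ((h + 1 : ℝ) * (T / y))‖
      ≤ ∑' h : ℕ, ‖σ (h + 1) * ciL K ((h + 1 : ℝ) * (T / y))‖ := norm_tsum_le_tsum_norm hns
    _ ≤ ∑' h : ℕ, u h := hns.tsum_le_tsum hbd hu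
    _ = C₁ * (y ^ 2 / T ^ 2) * ∑' h : ℕ, (1 + Real.log ((h : ℝ) + 1)) / ((h : ℝ) + 1) ^ 2 :=
        tsum_mul_left
    _ ≤ C₁ * (y ^ 2 / T ^ 2) * 3 := by gcongr
    _ = 3 * C₁ * (y ^ 2 / T ^ 2) := by ring

/-- The `h`-th integrand `y ↦ |g(y)|²σ(h+1)L((h+1)T/y)` is integrable on `(0,∞)` with
`∫|·| ≤ 2C₁Y³T⁻²(1+log(h+1))/(h+1)²`. [cite: ConreyIwaniec2002, §6 (6.29)–(6.31)] -/
theorem integrable_term (h : ℕ) :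
    IntegrableOn (fun y : ℝ => ‖g y‖ ^ 2 * (σ (h + 1) * ciL K (((h : ℝ) + 1) * (T / y)))) (Ioi 0) ∧
      ∫ y in Ioi (0:ℝ), ‖‖g y‖ ^ 2 * (σ (h + 1) * ciL K (((h : ℝ) + 1) * (T / y)))‖ ≤
        2 * C₁ * Y ^ 3 / T ^ 2 * ((1 + Real.log ((h : ℝ) + 1)) / ((h : ℝ) + 1) ^ 2) := by
  obtain ⟨hI3, hle3⟩ := integral_rpow_mul_normSq_g_le hY hg hgc (c := 3) (by norm_num) (by norm_num)
  set w : ℝ := C₁ / T ^ 2 * ((1 + Real.log ((h : ℝ) + 1)) / ((h : ℝ) + 1) ^ 2) with hw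
  have hw0 : 0 ≤ w := by
    have : 0 ≤ 1 + Real.log ((h : ℝ) + 1) := by
      have := Real.log_nonneg (by linarith [(Nat.cast_nonneg h : (0:ℝ) ≤ h)] : (1:ℝ) ≤ (h : ℝ) + 1)
      linarith
    positivity
  -- domination by `w · y² |g|²`
  have hdom : ∀ y ∈ Ioi (0:ℝ), ‖‖g y‖ ^ 2 * (σ (h + 1) * ciL K (((h : ℝ) + 1) * (T / y)))‖ ≤
      w * (y ^ ((3:ℝ) - 1) * ‖g y‖ ^ 2) := by
    intro y hy
    have hy' : (0:ℝ) < y := hy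
    rw [norm_mul, Real.norm_of_nonneg (sq_nonneg _), Real.norm_eq_abs]
    have ht := abs_term_le hK hC₁ hσ hT hy' h
    have e : y ^ ((3:ℝ) - 1) = y ^ 2 := by norm_num
    rw [e]
    calc ‖g y‖ ^ 2 * |σ (h + 1) * ciL K (((h : ℝ) + 1) * (T / y))|
        ≤ ‖g y‖ ^ 2 * (C₁ * (y ^ 2 / T ^ 2) * ((1 + Real.log ((h : ℝ) + 1)) / ((h : ℝ) + 1) ^ 2)) :=
          mul_le_mul_of_nonneg_left ht (sq_nonneg _)
      _ = w * (y ^ 2 * ‖g y‖ ^ 2) := by rw [hw]; field_simp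
  have hcont : ContinuousOn
      (fun y : ℝ => ‖g y‖ ^ 2 * (σ (h + 1) * ciL K (((h : ℝ) + 1) * (T / y)))) (Ioi 0) := by
    refine ((hgc.norm).pow 2).mul (continuousOn_const.mul ?_)
    refine (continuous_ciL hK).comp_continuousOn ?_
    exact continuousOn_const.mul (continuousOn_const.div continuousOn_id fun y hy => ne_of_gt hy)
  have hint : IntegrableOn
      (fun y : ℝ => ‖g y‖ ^ 2 * (σ (h + 1) * ciL K (((h : ℝ) + 1) * (T / y)))) (Ioi 0) := by
    refine Integrable.mono' (hI3.const_mul w) (hcont.aestronglyMeasurable measurableSet_Ioi) ?_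
    exact (ae_restrict_iff' measurableSet_Ioi).mpr (Eventually.of_forall hdom)
  refine ⟨hint, ?_⟩
  calc ∫ y in Ioi (0:ℝ), ‖‖g y‖ ^ 2 * (σ (h + 1) * ciL K (((h : ℝ) + 1) * (T / y)))‖
      ≤ ∫ y in Ioi (0:ℝ), w * (y ^ ((3:ℝ) - 1) * ‖g y‖ ^ 2) :=
        setIntegral_mono_on hint.norm (hI3.const_mul w) measurableSet_Ioi hdom
    _ = w * ∫ y in Ioi (0:ℝ), y ^ ((3:ℝ) - 1) * ‖g y‖ ^ 2 := integral_const_mul _ _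
    _ ≤ w * (2 * Y ^ (3:ℝ)) := mul_le_mul_of_nonneg_left hle3 hw0
    _ = 2 * C₁ * Y ^ 3 / T ^ 2 * ((1 + Real.log ((h : ℝ) + 1)) / ((h : ℝ) + 1) ^ 2) := by
        rw [hw, show (Y ^ (3:ℝ) : ℝ) = Y ^ (3:ℕ) by exact_mod_cast Real.rpow_natCast Y 3]; ring

/-- **(6.29): `Σ_{h≥1} σ(h)∫₀^∞|g|²L(hT/y)dy = ∫₀^∞|g(y)|²D(T/y)dy`** (absolutely convergent
interchange). [cite: ConreyIwaniec2002, §6 (6.29)] -/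
theorem tsum_sigma_integral_eq :
    ∑' h : ℕ, σ (h + 1) * ∫ y in Ioi (0:ℝ), ‖g y‖ ^ 2 * ciL K (((h + 1 : ℕ) : ℝ) * T / y) =
      ∫ y in Ioi (0:ℝ), ‖g y‖ ^ 2 * ciD K σ (T / y) := by
  have hF := fun h => (integrable_term hK hC₁ hσ hY hg hgc hT h)
  have hsum : Summable fun h : ℕ => ∫ y in Ioi (0:ℝ),
      ‖‖g y‖ ^ 2 * (σ (h + 1) * ciL K (((h : ℝ) + 1) * (T / y)))‖ := by
    refine Summable.of_nonneg_of_le (fun h => integral_nonneg fun y => norm_nonneg _)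
      (fun h => (hF h).2) ?_
    exact tsum_log_div_sq_le_three.1.mul_left _
  have hmain := integral_tsum_of_summable_integral_norm (μ := volume.restrict (Ioi (0:ℝ)))
    (fun h => (hF h).1) hsum
  -- left side
  have hL : ∀ h : ℕ, σ (h + 1) * ∫ y in Ioi (0:ℝ), ‖g y‖ ^ 2 * ciL K (((h + 1 : ℕ) : ℝ) * T / y) =
      ∫ y in Ioi (0:ℝ), ‖g y‖ ^ 2 * (σ (h + 1) * ciL K (((h : ℝ) + 1) * (T / y))) := by
    intro h
    rw [← integral_const_mul]
    refine setIntegral_congr_fun measurableSet_Ioi fun y _ => ?_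
    push_cast
    rw [mul_div_assoc]
    ring
  simp_rw [hL]
  rw [hmain]
  refine setIntegral_congr_fun measurableSet_Ioi fun y _ => ?_
  rw [tsum_mul_left, ciD]

/-- Summability of `h ↦ σ(h)∫|g|²L(hT/y)dy` with the bound `2C₁Y³T⁻²(1+log h)/h²` per term.
[cite: ConreyIwaniec2002, §6 (6.29)–(6.31)] -/
theorem abs_sigma_integral_le (h : ℕ) :
    |σ (h + 1) * ∫ y in Ioi (0:ℝ), ‖g y‖ ^ 2 * ciL K (((h + 1 : ℕ) : ℝ) * T / y)| ≤
      2 * C₁ * Y ^ 3 / T ^ 2 * ((1 + Real.log ((h : ℝ) + 1)) / ((h : ℝ) + 1) ^ 2) := by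
  have hF := integrable_term hK hC₁ hσ hY hg hgc hT h
  have e : σ (h + 1) * ∫ y in Ioi (0:ℝ), ‖g y‖ ^ 2 * ciL K (((h + 1 : ℕ) : ℝ) * T / y) =
      ∫ y in Ioi (0:ℝ), ‖g y‖ ^ 2 * (σ (h + 1) * ciL K (((h : ℝ) + 1) * (T / y))) := by
    rw [← integral_const_mul]
    refine setIntegral_congr_fun measurableSet_Ioi fun y _ => ?_
    push_cast
    rw [mul_div_assoc]
    ring
  rw [e, ← Real.norm_eq_abs]
  exact (norm_integral_le_integral_norm _).trans hF.2

/-- **The truncation of (6.29) at `h ≤ H`**: the series splits as `Σ_{h≤H} + tail` with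
`|tail| ≤ 2C₁Y³T⁻²(2+log H)/H` (`H ≥ 1`). [cite: ConreyIwaniec2002, §6 (6.29)–(6.31)] -/
theorem tsum_sigma_integral_split {H : ℕ} (hH : 1 ≤ H) :
    Summable (fun h : ℕ => σ (h + 1) * ∫ y in Ioi (0:ℝ), ‖g y‖ ^ 2 * ciL K (((h + 1 : ℕ) : ℝ) * T / y)) ∧
    ∑' h : ℕ, σ (h + 1) * ∫ y in Ioi (0:ℝ), ‖g y‖ ^ 2 * ciL K (((h + 1 : ℕ) : ℝ) * T / y) =
      (∑ h ∈ Icc 1 H, σ h * ∫ y in Ioi (0:ℝ), ‖g y‖ ^ 2 * ciL K ((h : ℝ) * T / y)) +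
        ∑' i : ℕ, σ (i + H + 1) * ∫ y in Ioi (0:ℝ), ‖g y‖ ^ 2 * ciL K (((i + H + 1 : ℕ) : ℝ) * T / y) ∧
    |∑' i : ℕ, σ (i + H + 1) * ∫ y in Ioi (0:ℝ), ‖g y‖ ^ 2 * ciL K (((i + H + 1 : ℕ) : ℝ) * T / y)| ≤
      2 * C₁ * Y ^ 3 / T ^ 2 * ((2 + Real.log H) / H) := by
  set f : ℕ → ℝ := fun h => σ (h + 1) * ∫ y in Ioi (0:ℝ), ‖g y‖ ^ 2 * ciL K (((h + 1 : ℕ) : ℝ) * T / y)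
    with hf
  set u : ℕ → ℝ := fun h => 2 * C₁ * Y ^ 3 / T ^ 2 * ((1 + Real.log ((h : ℝ) + 1)) / ((h : ℝ) + 1) ^ 2)
    with hu
  have hfu : ∀ h, ‖f h‖ ≤ u h := fun h => by
    rw [Real.norm_eq_abs]; exact abs_sigma_integral_le hK hC₁ hσ hY hg hgc hT h
  have hus : Summable u := tsum_log_div_sq_le_three.1.mul_left _
  have hfs : Summable f := Summable.of_norm_bounded hus hfu
  refine ⟨hfs, ?_, ?_⟩
  · rw [← hfs.sum_add_tsum_nat_add H]
    congr 1
    · have hI : Finset.Ico (0 + 1) (H + 1) = Finset.Icc 1 H := by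
        ext h; simp only [Finset.mem_Ico, Finset.mem_Icc]; omega
      rw [← hI, ← Finset.sum_Ico_add' (fun h : ℕ => σ h *
        ∫ y in Ioi (0:ℝ), ‖g y‖ ^ 2 * ciL K ((h : ℝ) * T / y)) 0 H 1, ← range_eq_Ico]
  · -- the tail
    obtain ⟨hts, htle⟩ := tsum_log_div_sq_shift_le hH
    set v : ℕ → ℝ := fun i => 2 * C₁ * Y ^ 3 / T ^ 2 *
      ((1 + Real.log ((i : ℝ) + H + 1)) / ((i : ℝ) + H + 1) ^ 2) with hv'
    have hv : Summable v := hts.mul_left _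
    have hbd : ∀ i : ℕ, ‖σ (i + H + 1) * ∫ y in Ioi (0:ℝ), ‖g y‖ ^ 2 *
        ciL K (((i + H + 1 : ℕ) : ℝ) * T / y)‖ ≤ v i := by
      intro i
      have h := hfu (i + H)
      simp only [hf, hu] at h
      simp only [hv']
      have e1 : ((i + H : ℕ) : ℝ) + 1 = (i : ℝ) + H + 1 := by push_cast; ring
      rw [e1] at h
      exact h
    have hns := Summable.of_nonneg_of_le (fun _ => norm_nonneg _) hbd hv
    rw [← Real.norm_eq_abs]
    calc ‖∑' i : ℕ, σ (i + H + 1) * ∫ y in Ioi (0:ℝ), ‖g y‖ ^ 2 * ciL K (((i + H + 1 : ℕ) : ℝ) * T / y)‖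
        ≤ ∑' i : ℕ, ‖σ (i + H + 1) * ∫ y in Ioi (0:ℝ), ‖g y‖ ^ 2 * ciL K (((i + H + 1 : ℕ) : ℝ) * T / y)‖ :=
          norm_tsum_le_tsum_norm hns
      _ ≤ ∑' i : ℕ, v i := hns.tsum_le_tsum hbd hv
      _ = 2 * C₁ * Y ^ 3 / T ^ 2 * ∑' i : ℕ, (1 + Real.log ((i : ℝ) + H + 1)) / ((i : ℝ) + H + 1) ^ 2 :=
          tsum_mul_left
      _ ≤ 2 * C₁ * Y ^ 3 / T ^ 2 * ((2 + Real.log H) / H) := by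
          have hY0 : 0 < Y := by linarith
          gcongr

/-- **The crude bound `|∫₀^∞|g|²D(T/y)dy| ≤ 6C₁Y³/T²`** (used when `H₀ < 1`).
[cite: ConreyIwaniec2002, §6 (6.29)–(6.31)] -/
theorem abs_integral_normSq_ciD_le :
    |∫ y in Ioi (0:ℝ), ‖g y‖ ^ 2 * ciD K σ (T / y)| ≤ 6 * C₁ * Y ^ 3 / T ^ 2 := by
  obtain ⟨hI3, hle3⟩ := integral_rpow_mul_normSq_g_le hY hg hgc (c := 3) (by norm_num) (by norm_num)
  have hdom : ∀ y ∈ Ioi (0:ℝ), ‖‖g y‖ ^ 2 * ciD K σ (T / y)‖ ≤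
      3 * C₁ / T ^ 2 * (y ^ ((3:ℝ) - 1) * ‖g y‖ ^ 2) := by
    intro y hy
    have hy' : (0:ℝ) < y := hy
    have hD := (ciD_bound hK hC₁ hσ hT hy').2
    rw [norm_mul, Real.norm_of_nonneg (sq_nonneg _), Real.norm_eq_abs,
      show y ^ ((3:ℝ) - 1) = y ^ 2 by norm_num]
    calc ‖g y‖ ^ 2 * |ciD K σ (T / y)| ≤ ‖g y‖ ^ 2 * (3 * C₁ * (y ^ 2 / T ^ 2)) :=
          mul_le_mul_of_nonneg_left hD (sq_nonneg _)
      _ = 3 * C₁ / T ^ 2 * (y ^ 2 * ‖g y‖ ^ 2) := by field_simp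
  rw [← Real.norm_eq_abs]
  calc ‖∫ y in Ioi (0:ℝ), ‖g y‖ ^ 2 * ciD K σ (T / y)‖
      ≤ ∫ y in Ioi (0:ℝ), ‖‖g y‖ ^ 2 * ciD K σ (T / y)‖ := norm_integral_le_integral_norm _
    _ ≤ ∫ y in Ioi (0:ℝ), 3 * C₁ / T ^ 2 * (y ^ ((3:ℝ) - 1) * ‖g y‖ ^ 2) := by
        refine integral_mono_of_nonneg (Eventually.of_forall fun y => norm_nonneg _)
          (hI3.const_mul _) ?_
        exact (ae_restrict_iff' measurableSet_Ioi).mpr (Eventually.of_forall hdom)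
    _ = 3 * C₁ / T ^ 2 * ∫ y in Ioi (0:ℝ), y ^ ((3:ℝ) - 1) * ‖g y‖ ^ 2 := integral_const_mul _ _
    _ ≤ 3 * C₁ / T ^ 2 * (2 * Y ^ (3:ℝ)) := mul_le_mul_of_nonneg_left hle3 (by positivity)
    _ = 6 * C₁ * Y ^ 3 / T ^ 2 := by
        rw [show (Y ^ (3:ℝ) : ℝ) = Y ^ (3:ℕ) by exact_mod_cast Real.rpow_natCast Y 3]; ring

end Series

/-! ### The crude bound for `S*(1)` (6.9)–(6.10) -/

/-- **`|S*(1)| ≤ G₂/T²`**: for `b₀ = 0` and `G₂ = Σ n²|b_n|² < ∞`,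
`|Σ_n b_{n+1} b̄_n L(T/n)| ≤ G₂/T²` (`|L(v)| ≤ v⁻²`, `2|b_{n+1}b_n| ≤ |b_{n+1}|² + |b_n|²`,
`n² ≤ (n+1)²`). [cite: ConreyIwaniec2002, §6 (6.9)–(6.10)] -/
theorem norm_shiftedSum_one_le {K : ℝ → ℝ} (hK : IsCIKernel K) {b : ℕ → ℂ} (hb0 : b 0 = 0)
    (hG : Summable fun n : ℕ => (n : ℝ) ^ 2 * ‖b n‖ ^ 2) {T : ℝ} (hT : 0 < T) :
    ‖∑' n : ℕ, b (n + 1) * starRingEnd ℂ (b n) * (ciL K (T / n) : ℂ)‖ ≤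
      (∑' n : ℕ, (n : ℝ) ^ 2 * ‖b n‖ ^ 2) / T ^ 2 := by
  set G : ℕ → ℝ := fun n => (n : ℝ) ^ 2 * ‖b n‖ ^ 2 with hGdef
  -- the shifted series `Σ n²|b_{n+1}|² ≤ G₂`
  have hshift_le : ∀ n : ℕ, (n : ℝ) ^ 2 * ‖b (n + 1)‖ ^ 2 ≤ G (n + 1) := fun n => by
    simp only [hGdef]; push_cast
    exact mul_le_mul_of_nonneg_right (by nlinarith [(Nat.cast_nonneg n : (0:ℝ) ≤ n)]) (sq_nonneg _)
  have hGs1 : Summable fun n : ℕ => G (n + 1) := (summable_nat_add_iff 1).mpr hG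
  have hshift_s : Summable fun n : ℕ => (n : ℝ) ^ 2 * ‖b (n + 1)‖ ^ 2 :=
    Summable.of_nonneg_of_le (fun n => by positivity) hshift_le hGs1
  have hG1 : ∑' n : ℕ, G (n + 1) = ∑' n : ℕ, G n := by
    rw [hG.tsum_eq_zero_add]; simp [hGdef]
  -- termwise bound
  set u : ℕ → ℝ := fun n => ((n : ℝ) ^ 2 * ‖b (n + 1)‖ ^ 2 + G n) / (2 * T ^ 2) with hu
  have hus : Summable u := (hshift_s.add hG).div_const _
  have hbd : ∀ n : ℕ, ‖b (n + 1) * starRingEnd ℂ (b n) * (ciL K (T / n) : ℂ)‖ ≤ u n := by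
    intro n
    rcases Nat.eq_zero_or_pos n with rfl | hn
    · simp [hb0, hu, hGdef]
    have hn0 : (0:ℝ) < n := by exact_mod_cast hn
    have hL : |ciL K (T / n)| ≤ ((T / n) ^ 2)⁻¹ := abs_ciL_le_inv_sq hK (by positivity)
    rw [norm_mul, norm_mul, Complex.norm_real, Real.norm_eq_abs, Complex.norm_conj]
    have hab : ‖b (n + 1)‖ * ‖b n‖ ≤ (‖b (n + 1)‖ ^ 2 + ‖b n‖ ^ 2) / 2 := by
      nlinarith [sq_nonneg (‖b (n + 1)‖ - ‖b n‖)]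
    calc ‖b (n + 1)‖ * ‖b n‖ * |ciL K (T / n)| ≤ (‖b (n + 1)‖ ^ 2 + ‖b n‖ ^ 2) / 2 * ((T / n) ^ 2)⁻¹ :=
          mul_le_mul hab hL (abs_nonneg _) (by positivity)
      _ = u n := by simp only [hu, hGdef]; field_simp
  have hns := Summable.of_nonneg_of_le (fun _ => norm_nonneg _) hbd hus
  calc ‖∑' n : ℕ, b (n + 1) * starRingEnd ℂ (b n) * (ciL K (T / n) : ℂ)‖
      ≤ ∑' n : ℕ, ‖b (n + 1) * starRingEnd ℂ (b n) * (ciL K (T / n) : ℂ)‖ := norm_tsum_le_tsum_norm hns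
    _ ≤ ∑' n : ℕ, u n := hns.tsum_le_tsum hbd hus
    _ = ((∑' n : ℕ, (n : ℝ) ^ 2 * ‖b (n + 1)‖ ^ 2) + ∑' n : ℕ, G n) / (2 * T ^ 2) := by
        rw [hu, tsum_div_const, hshift_s.tsum_add hG]
    _ ≤ ((∑' n : ℕ, G (n + 1)) + ∑' n : ℕ, G n) / (2 * T ^ 2) :=
        div_le_div_of_nonneg_right (add_le_add (hshift_s.tsum_le_tsum hshift_le hGs1) le_rfl)
          (by positivity)
    _ = (∑' n : ℕ, G n) / T ^ 2 := by rw [hG1]; field_simp; ring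

end Thm61OffDiagSeries

end ConreyIwaniec2002

end Literature.NumberTheory.LFunctions

end
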